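import Literature.NumberTheory.QuadraticForms.PadicSquares
import Mathlib.NumberTheory.LegendreSymbol.Basic
import HarnessLib

/-!
# Square classes of integers in `ℚ_p`, read at finite precision — every prime `p`
# (team n1011, row T-LOC3L, FILE L1 — the generic-`p` twin of T-LOC3T's `PadicThreeSquareClass`)

HONEST FRAMING (cell `b2b-bsdres`, run/shared/lean/b2b/bsd-rank1-residual/, verbatim in every
file): the goal of the cell is to DELETE the COMBINATION-SHAPED residual classes of the
Birch–Swinnerton-Dyer formula for ALL analytic-rank `≤ 1` elliptic curves over `ℚ` — "full BSD
formula for every rank `≤ 1` curve in class `C`" assembled STRICTLY from published theorems — so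
that the rank-`≤ 1` remainder becomes exactly the CONSTRUCTION-SHAPED classes, which are TYPED
(missing-input `Prop`s), NOT attempted. This is not "finishing BSD". Team n1011 (N10/N11): research
route; this file is a TOOL (elementary `p`-adic arithmetic); nothing is booked by it; no mark / label
moved. THEOREMS ONLY: no definition, no named fact, no `sorry`.

## What

For a prime `p` and a precision `δ ≥ 1` with `δ ≥ 3` when `p = 2` (the consumer takes `δ_p = 3`
for `p = 2` and `δ_p = 1` otherwise):

* `isSquare_of_norm_sub_one_le` — `‖u - 1‖ ≤ p^{-δ}` implies `u` is a square in `ℚ_p`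
  (Hensel for `X² - u`: the tree's `padicInt_isSquare_of_toZMod_eq_one` (odd `p`) /
  `padicInt_isSquare_of_toZModPow_three_eq_one` (`p = 2`), Serre *Cours d'arithmétique* II §3.3).
* `isSquare_iff_of_norm_sub_le` — if `c ≠ 0` and `‖G - c‖ ≤ p^{-δ} ‖c‖` then `G ≠ 0` and
  `G` is a square iff `c` is (the square class is read at precision `δ` beyond the valuation).
* `norm_intCast_padic_eq` — `‖n‖_p = p^{-w}` when `p^w ∥ n`.
* **`isSquare_intCast_padic_iff`** — for an integer `n = p^w u`, `p ∤ u`: `n` is a square in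
  `ℚ_p` iff `w` is even and: `u ≡ 1 (mod 8)` if `p = 2`; `(u mod p)^{p/2} ≡ 1 (mod p)` (Euler's
  criterion, Mathlib `ZMod.euler_criterion`) if `p` is odd (Serre II §3.3 Thm 3 / Thm 4) — stated
  with the residue power as a natural-number congruence, so that FILE L3's computable flag
  `sqFlagAt` reads it by `decide`.

Consumer: FILE L3 `LocalThreeTorsionDeciderAt` (square class of `g(zᵢ)` at a certified root `zᵢ` of
`Ψ₃`, read at the approximation `cᵢ`). References: [Serre1973] Ch. II §3.3; Mathlib Hensel.
-/

set_option autoImplicit false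

noncomputable section

open scoped Classical
open Literature.NumberTheory.QuadraticForms

namespace Summit.BirchSwinnertonDyer.Rank1Residual.GaloisImage.PadicSquareClass

variable {p : ℕ} [hp : Fact p.Prime]

/-! ### Hensel: elements close to `1` are squares -/

/-- `1 < p` as reals. [folklore] -/
private theorem one_lt_p : (1 : ℝ) < p := by exact_mod_cast hp.out.one_lt

/-- An element `u ∈ ℚ_p` with `‖u - 1‖ ≤ p^{-δ}` is a square, for a precision `δ ≥ 1` with
`δ ≥ 3` when `p = 2`. [cite: Serre1973, Ch. II §3.3 Thm 3, Thm 4] -/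
theorem isSquare_of_norm_sub_one_le {δ : ℕ} (hδ1 : 1 ≤ δ) (hδ2 : p = 2 → 3 ≤ δ) {u : ℚ_[p]}
    (hu : ‖u - 1‖ ≤ (p : ℝ) ^ (-(δ : ℤ))) : IsSquare u := by
  have hlt1 : ‖u - 1‖ < 1 :=
    hu.trans_lt (zpow_lt_one_of_neg₀ one_lt_p (by omega))
  have hun : ‖u‖ ≤ 1 := by
    have : u = (u - 1) + 1 := by ring
    rw [this]
    exact (Padic.nonarchimedean _ _).trans (max_le hlt1.le (by simp))
  set U : ℤ_[p] := ⟨u, hun⟩ with hU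
  have hU1 : ‖U - 1‖ = ‖u - 1‖ := rfl
  suffices h : IsSquare U by
    obtain ⟨s, hs⟩ := h
    exact ⟨(s : ℚ_[p]), by rw [← PadicInt.coe_mul, ← hs]⟩
  by_cases h2 : p = 2
  · -- `p = 2`: `U ≡ 1 (mod 8)`
    apply padicInt_isSquare_of_toZModPow_three_eq_one
    have hmem : U - 1 ∈ (Ideal.span {(p : ℤ_[p]) ^ 3} : Ideal ℤ_[p]) := by
      rw [← PadicInt.norm_le_pow_iff_mem_span_pow, hU1]
      refine hu.trans ?_
      exact_mod_cast zpow_le_zpow_right₀ one_lt_p.le (by have := hδ2 h2; omega)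
    rw [← PadicInt.ker_toZModPow, RingHom.mem_ker, map_sub, map_one, sub_eq_zero] at hmem
    exact hmem
  · -- odd `p`: `U ≡ 1 (mod p)`
    apply padicInt_isSquare_of_toZMod_eq_one h2
    have hmem : U - 1 ∈ IsLocalRing.maximalIdeal ℤ_[p] := by
      rw [IsLocalRing.mem_maximalIdeal, PadicInt.mem_nonunits, hU1]; exact hlt1
    rw [← PadicInt.ker_toZMod, RingHom.mem_ker, map_sub, map_one, sub_eq_zero] at hmem
    exact hmem

/-- If `‖G - c‖ ≤ p^{-δ} ‖c‖` (`δ` as above) and `c ≠ 0` then `G = c · u` with `u` a square unit;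
hence `G ≠ 0` and `G` is a square iff `c` is. [folklore] -/
theorem isSquare_iff_of_norm_sub_le {δ : ℕ} (hδ1 : 1 ≤ δ) (hδ2 : p = 2 → 3 ≤ δ) {G c : ℚ_[p]}
    (hc : c ≠ 0) (h : ‖G - c‖ ≤ (p : ℝ) ^ (-(δ : ℤ)) * ‖c‖) :
    G ≠ 0 ∧ (IsSquare G ↔ IsSquare c) := by
  have hcn : 0 < ‖c‖ := norm_pos_iff.mpr hc
  set u := G / c with hu
  have hG : G = c * u := by rw [hu, mul_div_cancel₀ _ hc]
  have hu1 : ‖u - 1‖ ≤ (p : ℝ) ^ (-(δ : ℤ)) := by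
    have : u - 1 = (G - c) / c := by rw [hu]; field_simp
    rw [this, norm_div, div_le_iff₀ hcn]
    exact h
  obtain ⟨s, hs⟩ := isSquare_of_norm_sub_one_le hδ1 hδ2 hu1
  have hu0 : u ≠ 0 := by
    intro h0
    rw [h0, zero_sub, norm_neg, norm_one] at hu1
    exact absurd hu1 (not_le.mpr (zpow_lt_one_of_neg₀ one_lt_p (by omega)))
  have hs0 : s ≠ 0 := fun h0 => hu0 (by rw [hs, h0, mul_zero])
  refine ⟨by rw [hG]; exact mul_ne_zero hc hu0, ⟨fun ⟨r, hr⟩ => ?_, fun ⟨r, hr⟩ => ?_⟩⟩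
  · refine ⟨r / s, ?_⟩
    have : c = G / u := by rw [hG, mul_div_cancel_right₀ _ hu0]
    rw [this, hr, hs]; field_simp
  · exact ⟨r * s, by rw [hG, hr, hs]; ring⟩

/-! ### Norms of integers -/

/-- The `p`-adic norm of an integer with `p^w ∥ n` is `p^{-w}`. [folklore] -/
theorem norm_intCast_padic_eq {n : ℤ} {w : ℕ} (hw : (p : ℤ) ^ w ∣ n)
    (hw' : ¬ (p : ℤ) ^ (w + 1) ∣ n) :
    ‖(n : ℚ_[p])‖ = (p : ℝ) ^ (-(w : ℤ)) := by
  have hle : ‖(n : ℚ_[p])‖ ≤ (p : ℝ) ^ (-(w : ℤ)) := by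
    exact_mod_cast (Padic.norm_int_le_pow_iff_dvd n w).mpr hw
  refine le_antisymm hle (le_of_not_gt fun hlt => hw' ?_)
  have hexp : (-((w + 1 : ℕ) : ℤ)) + 1 = -(w : ℤ) := by push_cast; ring
  have : ‖(n : ℚ_[p])‖ ≤ ((p : ℕ) : ℝ) ^ (-((w + 1 : ℕ) : ℤ)) := by
    rw [Padic.norm_le_pow_iff_norm_lt_pow_add_one, hexp]; exact_mod_cast hlt
  exact_mod_cast (Padic.norm_int_le_pow_iff_dvd n (w + 1)).mp this

/-! ### Unit squares reduce to squares -/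

/-- If a `p`-adic unit `u ∈ ℚ_p` (`‖u‖ = 1`) is a square, a square root has norm `1`. [folklore] -/
theorem norm_eq_one_of_sq_eq {u r : ℚ_[p]} (hu : ‖u‖ = 1) (hr : u = r * r) : ‖r‖ = 1 := by
  have h : ‖r‖ * ‖r‖ = 1 := by rw [← norm_mul, ← hr, hu]
  have hr0 : 0 ≤ ‖r‖ := norm_nonneg r
  nlinarith [h, hr0]

/-- **Odd or even `p`: a `p`-adic unit INTEGER which is a square in `ℚ_p` is a square modulo `p^k`**
for every `k` (a square root lies in `ℤ_pˣ` and reduces). [folklore] -/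
theorem isSquare_zmodPow_of_isSquare_padic {u : ℤ} (hu : ¬ (p : ℤ) ∣ u) (k : ℕ)
    (h : IsSquare ((u : ℚ_[p]))) :
    ∃ a : ZMod (p ^ k), IsUnit a ∧ ((u : ℤ) : ZMod (p ^ k)) = a ^ 2 := by
  obtain ⟨r, hr⟩ := h
  have hun : ‖(u : ℚ_[p])‖ = 1 := by
    -- (= the tree's `BinaryQuartic.norm_intCast_eq_one`; two lines, not worth the import)
    have := norm_intCast_padic_eq (p := p) (n := u) (w := 0) (by simp) (by simpa using hu)
    simpa using this
  have hrn : ‖r‖ = 1 := norm_eq_one_of_sq_eq hun hr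
  set R : ℤ_[p] := ⟨r, hrn.le⟩ with hR
  have hUR : ((u : ℤ_[p]) : ℚ_[p]) = ((R * R : ℤ_[p]) : ℚ_[p]) := by
    rw [PadicInt.coe_mul, PadicInt.coe_intCast]; exact hr
  have hUR' : (u : ℤ_[p]) = R * R := PadicInt.ext hUR
  have hRunit : IsUnit R := by rw [PadicInt.isUnit_iff]; exact hrn
  refine ⟨PadicInt.toZModPow k R, hRunit.map _, ?_⟩
  rw [sq, ← map_mul, ← hUR', map_intCast]

/-! ### Square classes of integers: odd `p` (Euler) -/

/-- Odd `p`: an integer whose residue is a non-zero square mod `p` is a square in `ℚ_p`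
(Hensel). [cite: Serre1973, Ch. II §3.3 Thm 3] -/
theorem isSquare_intCast_padic_of_isSquare_zmod (hp2 : p ≠ 2) {u : ℤ} (hu : ¬ (p : ℤ) ∣ u)
    (hsq : IsSquare ((u : ℤ) : ZMod p)) : IsSquare ((u : ℤ) : ℚ_[p]) := by
  obtain ⟨a, ha⟩ := hsq
  have h0 : ((u : ℤ) : ZMod p) ≠ 0 := by
    rwa [Ne, ZMod.intCast_zmod_eq_zero_iff_dvd]
  have ha0 : a ≠ 0 := fun h => h0 (by rw [ha, h, mul_zero])
  obtain ⟨B, hB⟩ : ∃ B : ℕ, (B : ZMod p) = a⁻¹ := ⟨(a⁻¹).val, ZMod.natCast_zmod_val _⟩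
  have hab : a * (B : ZMod p) = 1 := by rw [hB]; exact mul_inv_cancel₀ ha0
  have hB0 : B ≠ 0 := fun h => by
    rw [h, Nat.cast_zero, mul_zero] at hab; exact zero_ne_one hab
  set U : ℤ_[p] := (u : ℤ_[p]) * (B : ℤ_[p]) ^ 2 with hUdef
  have hU1 : PadicInt.toZMod U = 1 := by
    simp only [hUdef, map_mul, map_pow, map_intCast, map_natCast, ha]
    linear_combination (a * (B : ZMod p) + 1) * hab
  obtain ⟨s, hs⟩ := padicInt_isSquare_of_toZMod_eq_one hp2 hU1
  have hBq : ((B : ℕ) : ℚ_[p]) ≠ 0 := by exact_mod_cast hB0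
  have hs' : ((u : ℤ) : ℚ_[p]) * ((B : ℕ) : ℚ_[p]) ^ 2 = (s : ℚ_[p]) * (s : ℚ_[p]) := by
    have := congrArg ((↑) : ℤ_[p] → ℚ_[p]) hs
    push_cast [hUdef] at this
    exact this
  refine ⟨(s : ℚ_[p]) / ((B : ℕ) : ℚ_[p]), ?_⟩
  field_simp
  linear_combination hs'

/-- Euler's criterion, `Bool` form: for `p ∤ u`, `((u mod p)^{p/2}) mod p = 1` iff `u` is a
square mod `p` (Mathlib `ZMod.euler_criterion`; meaningful for odd `p`). [folklore] -/
theorem euler_flag_iff {u : ℤ} (hu : ¬ (p : ℤ) ∣ u) :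
    ((((u % (p : ℤ)).toNat ^ (p / 2)) % p == 1) = true) ↔ IsSquare ((u : ℤ) : ZMod p) := by
  have hp0 : (p : ℤ) ≠ 0 := by exact_mod_cast hp.out.ne_zero
  have h0 : ((u : ℤ) : ZMod p) ≠ 0 := by rwa [Ne, ZMod.intCast_zmod_eq_zero_iff_dvd]
  -- the residue `r = u mod p` as a natural number, and its cast
  set r : ℕ := (u % (p : ℤ)).toNat with hr
  have hr0 : (0 : ℤ) ≤ u % (p : ℤ) := Int.emod_nonneg _ hp0
  have hrz : (r : ℤ) = u % (p : ℤ) := by rw [hr, Int.toNat_of_nonneg hr0]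
  have hru : ((r : ℕ) : ZMod p) = ((u : ℤ) : ZMod p) := by
    rw [← Int.cast_natCast, hrz, ZMod.intCast_mod]
  rw [ZMod.euler_criterion p h0, ← hru, beq_iff_eq]
  constructor
  · intro h
    have : (((r ^ (p / 2) : ℕ) : ZMod p)) = ((1 : ℕ) : ZMod p) := by
      rw [ZMod.natCast_eq_natCast_iff', h, Nat.one_mod_eq_one.mpr hp.out.one_lt.ne']
    simpa using this
  · intro h
    have : (((r ^ (p / 2) : ℕ) : ZMod p)) = ((1 : ℕ) : ZMod p) := by simpa using h
    rw [ZMod.natCast_eq_natCast_iff'] at this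
    rw [this]; exact Nat.one_mod_eq_one.mpr hp.out.one_lt.ne'

/-- In `ZMod p` (`p` odd) the square of a unit reduces Euler's power to `1`. [folklore] -/
private theorem isSquare_zmod_of_isSquare_padic {u : ℤ} (hu : ¬ (p : ℤ) ∣ u)
    (h : IsSquare ((u : ℚ_[p]))) : IsSquare ((u : ℤ) : ZMod p) := by
  obtain ⟨a, -, ha⟩ := isSquare_zmodPow_of_isSquare_padic hu 1 h
  refine ⟨(ZMod.castHom (by rw [pow_one]) (ZMod p) a), ?_⟩
  have := congrArg (ZMod.castHom (show p ∣ p ^ 1 by rw [pow_one]) (ZMod p)) ha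
  simpa [sq] using this

/-! ### Square classes of integers: `p = 2` (mod `8`) -/

/-- In `ZMod 8` the square of a unit is `1`. [folklore] -/
private theorem sq_eq_one_of_isUnit_zmod_eight (a : ZMod 8) (ha : IsUnit a) : a ^ 2 = 1 := by
  revert a; decide

/-- `p = 2`: an odd integer which is a square in `ℚ₂` is `≡ 1 (mod 8)`. [cite: Serre1973, Ch. II §3.3 Thm 4] -/
theorem emod_eight_eq_one_of_isSquare_padicTwo {u : ℤ} (hu : ¬ (2 : ℤ) ∣ u)
    (h : IsSquare ((u : ℚ_[2]))) : u % 8 = 1 := by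
  obtain ⟨a, ha, hua⟩ := isSquare_zmodPow_of_isSquare_padic (p := 2) (by exact_mod_cast hu) 3 h
  have h8 : ((u : ℤ) : ZMod (2 ^ 3)) = 1 := by
    rw [hua]; exact sq_eq_one_of_isUnit_zmod_eight a ha
  have : ((u : ℤ) : ZMod 8) = ((1 : ℤ) : ZMod 8) := by simpa using h8
  rw [ZMod.intCast_eq_intCast_iff] at this
  have := this  -- `u ≡ 1 [ZMOD 8]`
  unfold Int.ModEq at this
  simpa using this

/-- `p = 2`: an integer `≡ 1 (mod 8)` is a square in `ℚ₂`. [cite: Serre1973, Ch. II §3.3 Thm 4] -/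
theorem isSquare_intCast_padicTwo_of_emod_eight {u : ℤ} (h : u % 8 = 1) :
    IsSquare ((u : ℤ) : ℚ_[2]) := by
  have h1 : PadicInt.toZModPow 3 ((u : ℤ) : ℤ_[2]) = 1 := by
    rw [map_intCast]
    have : ((u : ℤ) : ZMod (2 ^ 3)) = ((1 : ℤ) : ZMod (2 ^ 3)) := by
      rw [ZMod.intCast_eq_intCast_iff]
      show u ≡ 1 [ZMOD ((2 ^ 3 : ℕ) : ℤ)]
      unfold Int.ModEq; simpa using h
    rw [this, Int.cast_one]
  obtain ⟨s, hs⟩ := padicInt_isSquare_of_toZModPow_three_eq_one h1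
  refine ⟨(s : ℚ_[2]), ?_⟩
  have := congrArg ((↑) : ℤ_[2] → ℚ_[2]) hs
  simpa using this

/-! ### The flag theorem -/

/-- Valuation bookkeeping: if `n = p^w u` (`p ∤ u`) is a square in `ℚ_p` then `w` is even and `u`
is a square in `ℚ_p`. [cite: Serre1973, Ch. II §3.3] -/
theorem even_and_isSquare_unit_of_isSquare {n u : ℤ} {w : ℕ} (hn : n = (p : ℤ) ^ w * u)
    (hu : ¬ (p : ℤ) ∣ u) (h : IsSquare ((n : ℚ_[p]))) :
    w % 2 = 0 ∧ IsSquare ((u : ℚ_[p])) := by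
  obtain ⟨s, hs⟩ := h
  have hpR : (p : ℝ) ≠ 0 := by exact_mod_cast hp.out.ne_zero
  have hpQ : (p : ℚ_[p]) ≠ 0 := by exact_mod_cast hp.out.ne_zero
  have hw : (p : ℤ) ^ w ∣ n := ⟨u, hn⟩
  have hw' : ¬ (p : ℤ) ^ (w + 1) ∣ n := by
    rintro ⟨v, hv⟩
    apply hu
    refine ⟨v, ?_⟩
    have hpw : (p : ℤ) ^ w ≠ 0 := pow_ne_zero _ (by exact_mod_cast hp.out.ne_zero)
    have : (p : ℤ) ^ w * u = (p : ℤ) ^ w * (p * v) := by rw [← hn, hv]; ring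
    exact mul_left_cancel₀ hpw this
  have hn0 : (n : ℚ_[p]) ≠ 0 := by
    have : n ≠ 0 := by rintro rfl; exact hw' (dvd_zero _)
    exact_mod_cast this
  have hs0 : s ≠ 0 := fun h0 => hn0 (by rw [hs, h0, mul_zero])
  have hnn : ‖(n : ℚ_[p])‖ = (p : ℝ) ^ (-(w : ℤ)) := norm_intCast_padic_eq hw hw'
  have hsv := Padic.norm_eq_zpow_neg_valuation hs0
  have hw2 : (w : ℤ) = 2 * s.valuation := by
    have : ((p : ℕ) : ℝ) ^ (-(w : ℤ)) = ((p : ℕ) : ℝ) ^ (-s.valuation + -s.valuation) := by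
      rw [zpow_add₀ (by exact_mod_cast hp.out.ne_zero), ← hsv, ← norm_mul, ← hs]
      exact_mod_cast hnn.symm
    have hinj := (zpow_right_injective₀ (a := ((p : ℕ) : ℝ)) (by exact_mod_cast hp.out.pos)
      (by exact_mod_cast hp.out.one_lt.ne')) this
    omega
  refine ⟨by omega, ?_⟩
  set v := s.valuation with hv
  set r : ℚ_[p] := s / (p : ℚ_[p]) ^ v with hr
  refine ⟨r, ?_⟩
  have hn' : (n : ℚ_[p]) = (p : ℚ_[p]) ^ (w : ℤ) * u := by
    rw [hn]; push_cast; rw [zpow_natCast]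
  have : (u : ℚ_[p]) = (n : ℚ_[p]) / (p : ℚ_[p]) ^ (w : ℤ) := by
    rw [hn', mul_div_cancel_left₀ _ (zpow_ne_zero _ hpQ)]
  rw [this, hs, hr, hw2, two_mul, zpow_add₀ hpQ, div_mul_div_comm]

/-- **Square classes of integers in `ℚ_p`, every prime `p`.** For an integer `n` with `p^w ∥ n`:
`n` is a square in `ℚ_p` iff `w` is even and: `n/p^w ≡ 1 (mod 8)` if `p = 2`;
`((n/p^w) mod p)^{p/2} ≡ 1 (mod p)` (Euler) if `p` is odd.
[cite: Serre1973, Ch. II §3.3 Thm 3, Thm 4] -/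
theorem isSquare_intCast_padic_iff (n : ℤ) (w : ℕ) (hw : (p : ℤ) ^ w ∣ n)
    (hw' : ¬ (p : ℤ) ^ (w + 1) ∣ n) :
    IsSquare (n : ℚ_[p]) ↔
      (w % 2 = 0 ∧ (p = 2 → (n / (p : ℤ) ^ w) % 8 = 1) ∧
        (p ≠ 2 → (((n / (p : ℤ) ^ w) % (p : ℤ)).toNat ^ (p / 2)) % p = 1)) := by
  obtain ⟨u, hu⟩ := hw
  have hp0 : (p : ℤ) ≠ 0 := by exact_mod_cast hp.out.ne_zero
  have hpw : (p : ℤ) ^ w ≠ 0 := pow_ne_zero _ hp0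
  have hdiv : n / (p : ℤ) ^ w = u := by rw [hu, Int.mul_ediv_cancel_left _ hpw]
  have hup : ¬ (p : ℤ) ∣ u := by
    rintro ⟨v, rfl⟩; exact hw' ⟨v, by rw [hu]; ring⟩
  have heven_sq : ∀ {j : ℕ}, w = 2 * j → IsSquare ((u : ℚ_[p])) → IsSquare ((n : ℚ_[p])) := by
    rintro j rfl ⟨s, hs⟩
    exact ⟨(p : ℚ_[p]) ^ j * s, by rw [hu]; push_cast; rw [hs]; ring⟩
  rw [hdiv]
  by_cases h2 : p = 2
  · subst h2
    constructor
    · intro h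
      obtain ⟨hwe, hsq⟩ := even_and_isSquare_unit_of_isSquare hu hup h
      exact ⟨hwe, fun _ => emod_eight_eq_one_of_isSquare_padicTwo (by exact_mod_cast hup) hsq,
        fun h => absurd rfl h⟩
    · rintro ⟨hwe, h8, -⟩
      exact heven_sq (j := w / 2) (by omega) (isSquare_intCast_padicTwo_of_emod_eight (h8 rfl))
  · have heuler := euler_flag_iff (p := p) hup
    rw [beq_iff_eq] at heuler
    constructor
    · intro h
      obtain ⟨hwe, hsq⟩ := even_and_isSquare_unit_of_isSquare hu hup h
      exact ⟨hwe, fun h => absurd h h2, fun _ => heuler.mpr (isSquare_zmod_of_isSquare_padic hup hsq)⟩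
    · rintro ⟨hwe, -, hE⟩
      exact heven_sq (j := w / 2) (by omega)
        (isSquare_intCast_padic_of_isSquare_zmod h2 hup (heuler.mp (hE h2)))

end Summit.BirchSwinnertonDyer.Rank1Residual.GaloisImage.PadicSquareClass

end
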